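import Literature.Analysis.FluidPDE.NSSpinHeatEquationProofs
import HarnessLib

/-!
# The weak vorticity equation of a bounded local weak Navier–Stokes solution on product cylinders

Analysis/FluidPDE proofs file (theorems only; no definitions, no named facts). The accepted
`NSSpinHeatEquation_holds` (`NSSpinHeatEquationProofs.lean`; Robinson–Rodrigo–Sadowski 2016,
Thm. 12.1 with (12.4), local form of §13.3.2 Step 1) states the weak vorticity equation
`∫∫ A_{bc}(∂ₜψ + Δψ) = ∫∫ ⟪spinFlux u G b c, ∇ψ⟫` on *centred* parabolic cylinders `Q*_R(z)`. The
higher-regularity bootstrap (`NSBoundedHigherRegularityBounds`) is posed on *backward* cylinders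
`Q_R(z) = ]t - R², t[ × B(x, R)`; this file re-runs the accepted proof verbatim on an arbitrary
product cylinder `]t₁, t₂[ × B(x₀, R)` (`spinHeat_identity_prod`), which covers both. All the
cylinder-independent ingredients (test-field algebra, the slice product rule
`NSSpinHeat.setIntegral_fderiv_mul_inner_mul_inner`, coordinates `velC`/`gradE`/`heatTest`) are
imported from the accepted file; only the statements carrying the cylinder are repeated.

## References

* J. C. Robinson, J. L. Rodrigo, W. Sadowski, *The Three-Dimensional Navier–Stokes Equations*
  (CUP 2016), Thm. 12.1 with (12.2), (12.4), (12.5); §13.3.2 Step 1. [`RobinsonRodrigoSadowskiCUP2016`]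
* J. Serrin, Arch. Rational Mech. Anal. 9 (1962) 187–195. [`Serrin1962`]
-/

noncomputable section

open MeasureTheory Set Function Filter Topology TopologicalSpace Metric InnerProductSpace
open scoped NNReal ENNReal RealInnerProductSpace Laplacian ContDiff

namespace Literature.Analysis.FluidPDE

namespace NSSpinHeatProd

open NSSpinHeat

/-- A product cylinder `]t₁, t₂[ × B(x₀, R)` has finite measure. [folklore] -/
theorem volume_Ioo_prod_ball_lt_top (t₁ t₂ : ℝ) (x₀ : EuclideanSpace ℝ (Fin 3)) (R : ℝ) :
    volume (Ioo t₁ t₂ ×ˢ ball x₀ R) < ⊤ := by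
  rw [Measure.volume_eq_prod, Measure.prod_prod]
  exact ENNReal.mul_lt_top (by simp [Real.volume_Ioo]) measure_ball_lt_top

variable {u : ℝ → (EuclideanSpace ℝ (Fin 3)) → (EuclideanSpace ℝ (Fin 3))}
  {G : ℝ → (EuclideanSpace ℝ (Fin 3)) → (EuclideanSpace ℝ (Fin 3)) →L[ℝ] (EuclideanSpace ℝ (Fin 3))}
  {t₁ t₂ : ℝ} {x₀ : EuclideanSpace ℝ (Fin 3)} {R M : ℝ}

/-- Local integrability on the cylinder of the products `⟪e₁, u⟫ ⟪e₂, u⟫` of components of a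
bounded field. [folklore] -/
theorem locallyIntegrableOn_inner_mul_inner
    (hu : LocallyIntegrableOn (uncurry u) ((Ioo t₁ t₂ ×ˢ ball x₀ R)) volume)
    (hbd : ∀ᵐ q ∂(volume.restrict ((Ioo t₁ t₂ ×ˢ ball x₀ R))), ‖u q.1 q.2‖ ≤ M)
    (e₁ e₂ : (EuclideanSpace ℝ (Fin 3))) :
    LocallyIntegrableOn (fun q : ℝ × (EuclideanSpace ℝ (Fin 3)) => ⟪e₁, u q.1 q.2⟫ * ⟪e₂, u q.1 q.2⟫)
      ((Ioo t₁ t₂ ×ˢ ball x₀ R)) volume := by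
  have hum : AEStronglyMeasurable (uncurry u) (volume.restrict ((Ioo t₁ t₂ ×ˢ ball x₀ R))) :=
    hu.aestronglyMeasurable
  have hm : AEStronglyMeasurable (fun q : ℝ × (EuclideanSpace ℝ (Fin 3)) => ⟪e₁, u q.1 q.2⟫ * ⟪e₂, u q.1 q.2⟫)
      (volume.restrict ((Ioo t₁ t₂ ×ˢ ball x₀ R))) :=
    (aestronglyMeasurable_const.inner hum).mul (aestronglyMeasurable_const.inner hum)
  refine (IntegrableOn.of_bound (volume_Ioo_prod_ball_lt_top t₁ t₂ x₀ R) hm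
    (‖e₁‖ * |M| * (‖e₂‖ * |M|)) ?_).locallyIntegrableOn
  filter_upwards [hbd] with q hq
  rw [norm_mul]
  have h1 : ∀ e : (EuclideanSpace ℝ (Fin 3)), ‖⟪e, u q.1 q.2⟫‖ ≤ ‖e‖ * |M| := fun e =>
    (norm_inner_le_norm _ _).trans (mul_le_mul_of_nonneg_left (hq.trans (le_abs_self M))
      (norm_nonneg _))
  exact mul_le_mul (h1 e₁) (h1 e₂) (norm_nonneg _) (by positivity)

/-- Local integrability on the cylinder of `⟪e₁, u⟫ ⟪e₂, G a⟫` for a bounded field `u` and a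
locally integrable `G`. [folklore] -/
theorem locallyIntegrableOn_inner_mul_inner_grad
    (hu : LocallyIntegrableOn (uncurry u) ((Ioo t₁ t₂ ×ˢ ball x₀ R)) volume)
    (hbd : ∀ᵐ q ∂(volume.restrict ((Ioo t₁ t₂ ×ˢ ball x₀ R))), ‖u q.1 q.2‖ ≤ M)
    (hGl : LocallyIntegrableOn (uncurry G) ((Ioo t₁ t₂ ×ˢ ball x₀ R)) volume)
    (e₁ e₂ a : (EuclideanSpace ℝ (Fin 3))) :
    LocallyIntegrableOn (fun q : ℝ × (EuclideanSpace ℝ (Fin 3)) => ⟪e₁, u q.1 q.2⟫ * ⟪e₂, G q.1 q.2 a⟫)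
      ((Ioo t₁ t₂ ×ˢ ball x₀ R)) volume := by
  have hum : AEStronglyMeasurable (uncurry u) (volume.restrict ((Ioo t₁ t₂ ×ˢ ball x₀ R))) :=
    hu.aestronglyMeasurable
  have hGa : LocallyIntegrableOn (fun q : ℝ × (EuclideanSpace ℝ (Fin 3)) => ⟪e₂, G q.1 q.2 a⟫)
      ((Ioo t₁ t₂ ×ˢ ball x₀ R)) volume :=
    ((innerSL ℝ e₂).comp (ContinuousLinearMap.apply ℝ (EuclideanSpace ℝ (Fin 3)) a)).locallyIntegrableOn_comp hGl
  refine locallyIntegrableOn_bdd_mul hGa (aestronglyMeasurable_const.inner hum) (C := ‖e₁‖ * |M|) ?_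
  filter_upwards [hbd] with q hq
  exact (norm_inner_le_norm _ _).trans
    (mul_le_mul_of_nonneg_left (hq.trans (le_abs_self M)) (norm_nonneg _))

/-- Integrability over space–time of a test function times a function locally integrable on
the cylinder. [folklore] -/
theorem integrable_test_mul {f : ℝ × (EuclideanSpace ℝ (Fin 3)) → ℝ}
    (hf : LocallyIntegrableOn f ((Ioo t₁ t₂ ×ˢ ball x₀ R)) volume) {θ : ℝ → (EuclideanSpace ℝ (Fin 3)) → ℝ}
    (hθ : IsSpaceTimeTestOn ((⟨Ioo t₁ t₂ ×ˢ ball x₀ R, isOpen_Ioo.prod isOpen_ball⟩ : Opens (ℝ × (EuclideanSpace ℝ (Fin 3))))) θ) :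
    Integrable (fun q : ℝ × (EuclideanSpace ℝ (Fin 3)) => θ q.1 q.2 * f q) (volume : Measure (ℝ × (EuclideanSpace ℝ (Fin 3)))) := by
  have h := integrable_mul_of_locallyIntegrableOn (Q := (⟨Ioo t₁ t₂ ×ˢ ball x₀ R, isOpen_Ioo.prod isOpen_ball⟩ : Opens (ℝ × (EuclideanSpace ℝ (Fin 3))))) hf
    (w := uncurry θ) hθ.contDiff.continuous hθ.hasCompactSupport hθ.tsupport_subset
    (fun q hq => image_eq_zero_of_notMem_tsupport hq)
  refine h.congr (Eventually.of_forall fun q => ?_)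
  simp only [uncurry, mul_comm]

/-- **The weak product rule on a cylinder.** For a bounded field `u` with a weak spatial gradient
`G ∈ L²` on `Q*_R(z)`, the products of components satisfy, against every space–time test
function `θ ∈ C_c^∞(Q*_R(z))`,
`∫∫ ∂ₐθ ⟪e₁,u⟫⟪e₂,u⟫ = -∫∫ θ (⟪e₁,u⟫⟪e₂,∂ₐu⟫ + ⟪e₂,u⟫⟪e₁,∂ₐu⟫)`
(slice-wise: for a.e. `t`, `u(t, ·) ∈ W^{1,2}(B)` by the tree's slicing theorem, the slice rule
`setIntegral_fderiv_mul_inner_mul_inner`, and Fubini). [folklore] -/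
theorem integral_fderiv_mul_inner_mul_inner
    (hbd : ∀ᵐ q ∂(volume.restrict ((Ioo t₁ t₂ ×ˢ ball x₀ R))), ‖u q.1 q.2‖ ≤ M)
    (hG : HasWeakSpatialGradientOn ((⟨Ioo t₁ t₂ ×ˢ ball x₀ R, isOpen_Ioo.prod isOpen_ball⟩ : Opens (ℝ × (EuclideanSpace ℝ (Fin 3))))) u G)
    (hG2 : ∫⁻ q in Ioo t₁ t₂ ×ˢ ball x₀ R, ENNReal.ofReal (frobeniusNormSq (G q.1 q.2)) < ⊤)
    {θ : ℝ → (EuclideanSpace ℝ (Fin 3)) → ℝ} (hθ : IsSpaceTimeTestOn ((⟨Ioo t₁ t₂ ×ˢ ball x₀ R, isOpen_Ioo.prod isOpen_ball⟩ : Opens (ℝ × (EuclideanSpace ℝ (Fin 3))))) θ)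
    (a e₁ e₂ : (EuclideanSpace ℝ (Fin 3))) :
    ∫ q : ℝ × (EuclideanSpace ℝ (Fin 3)), fderiv ℝ (θ q.1) q.2 a * (⟪e₁, u q.1 q.2⟫ * ⟪e₂, u q.1 q.2⟫) =
      -∫ q : ℝ × (EuclideanSpace ℝ (Fin 3)), θ q.1 q.2 *
        (⟪e₁, u q.1 q.2⟫ * ⟪e₂, G q.1 q.2 a⟫ + ⟪e₂, u q.1 q.2⟫ * ⟪e₁, G q.1 q.2 a⟫) := by
  set I : Set ℝ := Ioo t₁ t₂ with hI
  set U : Opens (EuclideanSpace ℝ (Fin 3)) := ⟨ball x₀ R, isOpen_ball⟩ with hU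
  -- the cylinder as a product region
  have hle : (⟨I ×ˢ (U : Set (EuclideanSpace ℝ (Fin 3))), isOpen_Ioo.prod U.isOpen⟩ : Opens (ℝ × (EuclideanSpace ℝ (Fin 3)))) ≤
      (⟨Ioo t₁ t₂ ×ˢ ball x₀ R, isOpen_Ioo.prod isOpen_ball⟩ : Opens (ℝ × (EuclideanSpace ℝ (Fin 3)))) := fun q hq => hq
  have hge : (⟨Ioo t₁ t₂ ×ˢ ball x₀ R, isOpen_Ioo.prod isOpen_ball⟩ : Opens (ℝ × (EuclideanSpace ℝ (Fin 3)))) ≤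
      (⟨I ×ˢ (U : Set (EuclideanSpace ℝ (Fin 3))), isOpen_Ioo.prod U.isOpen⟩ : Opens (ℝ × (EuclideanSpace ℝ (Fin 3)))) := fun q hq => hq
  have hGρ : HasWeakSpatialGradientOn
      (⟨I ×ˢ (U : Set (EuclideanSpace ℝ (Fin 3))), isOpen_Ioo.prod U.isOpen⟩ : Opens (ℝ × (EuclideanSpace ℝ (Fin 3)))) u G := hG.mono hle
  have hθ' : IsSpaceTimeTestOn (⟨I ×ˢ (U : Set (EuclideanSpace ℝ (Fin 3))), isOpen_Ioo.prod U.isOpen⟩ : Opens (ℝ × (EuclideanSpace ℝ (Fin 3)))) θ :=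
    hθ.mono hge
  have hu : LocallyIntegrableOn (uncurry u) ((Ioo t₁ t₂ ×ˢ ball x₀ R)) volume :=
    hG.locallyIntegrableOn
  have hGl : LocallyIntegrableOn (uncurry G) ((Ioo t₁ t₂ ×ˢ ball x₀ R)) volume :=
    hG.locallyIntegrableOn_grad
  -- slices: weak gradient, bound, energy
  have hS1 : ∀ᵐ t ∂(volume.restrict I), FunctionSpaces.HasWeakFDerivOn U volume (u t) (G t) :=
    hGρ.ae_hasWeakFDerivOn_slice
  have hS2 : ∀ᵐ t ∂(volume.restrict I), ∀ᵐ x ∂(volume.restrict (ball x₀ R)), ‖u t x‖ ≤ M :=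
    SerrinBoundedHolder.ae_ae_of_ae_restrict_prod (P := fun w => ‖u w.1 w.2‖ ≤ M) hbd
  have hGm : AEStronglyMeasurable (uncurry G) (volume.restrict ((Ioo t₁ t₂ ×ˢ ball x₀ R))) :=
    hGl.aestronglyMeasurable
  have hS4 : ∀ᵐ t ∂(volume.restrict I), ∫⁻ x in ball x₀ R, ‖G t x‖ₑ ^ (2 : ℝ) < ⊤ := by
    refine SerrinBoundedHolder.ae_lintegral_lt_top_of_lintegral_prod
      (f := fun w => ‖G w.1 w.2‖ₑ ^ (2 : ℝ)) (hGm.aemeasurable.enorm.pow_const _) ?_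
    calc ∫⁻ w in I ×ˢ ball x₀ R, ‖G w.1 w.2‖ₑ ^ (2 : ℝ)
        ≤ ∫⁻ w in Ioo t₁ t₂ ×ˢ ball x₀ R, ENNReal.ofReal (frobeniusNormSq (G w.1 w.2)) :=
          lintegral_mono fun w => SerrinBoundedHolder.enorm_rpow_two_le_ofReal_frobeniusNormSq _
      _ < ⊤ := hG2
  -- the slice identity for a.e. `t`
  have hslice : ∀ᵐ t ∂(volume.restrict I),
      ∫ x in ball x₀ R, fderiv ℝ (θ t) x a * (⟪e₁, u t x⟫ * ⟪e₂, u t x⟫) =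
        -∫ x in ball x₀ R, θ t x * (⟪e₁, u t x⟫ * ⟪e₂, G t x a⟫ + ⟪e₂, u t x⟫ * ⟪e₁, G t x a⟫) := by
    filter_upwards [hS1, hS2, hS4] with t h1 h2 h4
    haveI : IsFiniteMeasure (volume.restrict (ball x₀ R)) :=
      isFiniteMeasure_restrict.2 measure_ball_lt_top.ne
    have hv2 : MemLp (u t) 2 (volume.restrict (ball x₀ R)) :=
      MemLp.of_bound h1.locallyIntegrableOn.aestronglyMeasurable M h2
    have hg2 : MemLp (G t) 2 (volume.restrict (ball x₀ R)) := by
      refine ⟨h1.locallyIntegrableOn_deriv.aestronglyMeasurable, ?_⟩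
      rw [eLpNorm_eq_lintegral_rpow_enorm_toReal two_ne_zero ENNReal.ofNat_ne_top,
        ENNReal.toReal_ofNat]
      exact ENNReal.rpow_lt_top_of_nonneg (by norm_num) h4.ne
    exact setIntegral_fderiv_mul_inner_mul_inner h1 hv2 hg2 (isTestFunctionOn_slice hθ' t) a e₁ e₂
  -- integrability of both space–time integrands
  have hdθ := isSpaceTimeTestOn_fderiv_apply hθ a
  have IL : Integrable (fun q : ℝ × (EuclideanSpace ℝ (Fin 3)) =>
      fderiv ℝ (θ q.1) q.2 a * (⟪e₁, u q.1 q.2⟫ * ⟪e₂, u q.1 q.2⟫)) (volume : Measure (ℝ × (EuclideanSpace ℝ (Fin 3)))) :=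
    integrable_test_mul (locallyIntegrableOn_inner_mul_inner hu hbd e₁ e₂) hdθ
  have IR : Integrable (fun q : ℝ × (EuclideanSpace ℝ (Fin 3)) => θ q.1 q.2 *
      (⟪e₁, u q.1 q.2⟫ * ⟪e₂, G q.1 q.2 a⟫ + ⟪e₂, u q.1 q.2⟫ * ⟪e₁, G q.1 q.2 a⟫))
      (volume : Measure (ℝ × (EuclideanSpace ℝ (Fin 3)))) :=
    integrable_test_mul ((locallyIntegrableOn_inner_mul_inner_grad hu hbd hGl e₁ e₂ a).add
      (locallyIntegrableOn_inner_mul_inner_grad hu hbd hGl e₂ e₁ a)) hθ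
  -- both integrands vanish off the cylinder
  have h0L : ∀ q : ℝ × (EuclideanSpace ℝ (Fin 3)), q ∉ I ×ˢ ball x₀ R →
      fderiv ℝ (θ q.1) q.2 a * (⟪e₁, u q.1 q.2⟫ * ⟪e₂, u q.1 q.2⟫) = 0 := by
    intro q hq
    have hq' : q ∉ tsupport (uncurry fun t x => fderiv ℝ (θ t) x a) := fun h => hq (hdθ.tsupport_subset h)
    have h0 := image_eq_zero_of_notMem_tsupport hq'
    have : fderiv ℝ (θ q.1) q.2 a = 0 := h0
    rw [this, zero_mul]
  have h0R : ∀ q : ℝ × (EuclideanSpace ℝ (Fin 3)), q ∉ I ×ˢ ball x₀ R → θ q.1 q.2 *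
      (⟪e₁, u q.1 q.2⟫ * ⟪e₂, G q.1 q.2 a⟫ + ⟪e₂, u q.1 q.2⟫ * ⟪e₁, G q.1 q.2 a⟫) = 0 := by
    intro q hq
    have hq' : q ∉ tsupport (uncurry θ) := fun h => hq (hθ.tsupport_subset h)
    have h0 := image_eq_zero_of_notMem_tsupport hq'
    have : θ q.1 q.2 = 0 := h0
    rw [this, zero_mul]
  rw [integral_eq_iterated_of_eq_zero_off IL h0L, integral_eq_iterated_of_eq_zero_off IR h0R,
    ← integral_neg]
  refine integral_congr_ae ?_
  filter_upwards [hslice] with t ht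
  exact ht

variable {p : ℝ → (EuclideanSpace ℝ (Fin 3)) → ℝ}


/-- The velocity components are locally integrable on the cylinder. [folklore] -/
theorem locallyIntegrableOn_velC
    (hu : LocallyIntegrableOn (uncurry u) ((Ioo t₁ t₂ ×ˢ ball x₀ R)) volume) (i : Fin 3) :
    LocallyIntegrableOn (velC u i) ((Ioo t₁ t₂ ×ˢ ball x₀ R)) volume :=
  (EuclideanSpace.proj i : (EuclideanSpace ℝ (Fin 3)) →L[ℝ] ℝ).locallyIntegrableOn_comp hu

/-- The gradient entries are locally integrable on the cylinder. [folklore] -/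
theorem locallyIntegrableOn_gradE
    (hGl : LocallyIntegrableOn (uncurry G) ((Ioo t₁ t₂ ×ˢ ball x₀ R)) volume) (i j : Fin 3) :
    LocallyIntegrableOn (gradE G i j) ((Ioo t₁ t₂ ×ˢ ball x₀ R)) volume :=
  ((EuclideanSpace.proj i : (EuclideanSpace ℝ (Fin 3)) →L[ℝ] ℝ).comp (ContinuousLinearMap.apply ℝ (EuclideanSpace ℝ (Fin 3)) ((EuclideanSpace.single j (1 : ℝ))))).locallyIntegrableOn_comp hGl

/-- Products of velocity components are locally integrable on the cylinder. [folklore] -/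
theorem locallyIntegrableOn_velC_mul_velC
    (hu : LocallyIntegrableOn (uncurry u) ((Ioo t₁ t₂ ×ˢ ball x₀ R)) volume)
    (hbd : ∀ᵐ q ∂(volume.restrict ((Ioo t₁ t₂ ×ˢ ball x₀ R))), ‖u q.1 q.2‖ ≤ M)
    (i k : Fin 3) :
    LocallyIntegrableOn (fun q => velC u i q * velC u k q) ((Ioo t₁ t₂ ×ˢ ball x₀ R)) volume := by
  have h := locallyIntegrableOn_inner_mul_inner hu hbd ((EuclideanSpace.single i (1 : ℝ))) ((EuclideanSpace.single k (1 : ℝ)))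
  simpa using h

/-- Velocity components times gradient entries are locally integrable on the cylinder. [folklore] -/
theorem locallyIntegrableOn_velC_mul_gradE
    (hu : LocallyIntegrableOn (uncurry u) ((Ioo t₁ t₂ ×ˢ ball x₀ R)) volume)
    (hbd : ∀ᵐ q ∂(volume.restrict ((Ioo t₁ t₂ ×ˢ ball x₀ R))), ‖u q.1 q.2‖ ≤ M)
    (hGl : LocallyIntegrableOn (uncurry G) ((Ioo t₁ t₂ ×ˢ ball x₀ R)) volume)
    (j i k : Fin 3) :
    LocallyIntegrableOn (fun q => velC u j q * gradE G i k q) ((Ioo t₁ t₂ ×ˢ ball x₀ R))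
      volume := by
  have h := locallyIntegrableOn_inner_mul_inner_grad hu hbd hGl ((EuclideanSpace.single j (1 : ℝ))) ((EuclideanSpace.single i (1 : ℝ))) ((EuclideanSpace.single k (1 : ℝ)))
  simpa using h

/-- **The weak-gradient identity in coordinates** (product-integral form):
`∫∫ φ Gᵢⱼ = -∫∫ (∂ⱼφ) uᵢ` for every space–time test function `φ` on the cylinder. [folklore] -/
theorem integral_test_mul_gradE
    (hG : HasWeakSpatialGradientOn ((⟨Ioo t₁ t₂ ×ˢ ball x₀ R, isOpen_Ioo.prod isOpen_ball⟩ : Opens (ℝ × (EuclideanSpace ℝ (Fin 3))))) u G) {φ : ℝ → (EuclideanSpace ℝ (Fin 3)) → ℝ}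
    (hφ : IsSpaceTimeTestOn ((⟨Ioo t₁ t₂ ×ˢ ball x₀ R, isOpen_Ioo.prod isOpen_ball⟩ : Opens (ℝ × (EuclideanSpace ℝ (Fin 3))))) φ) (i j : Fin 3) :
    ∫ q : ℝ × (EuclideanSpace ℝ (Fin 3)), φ q.1 q.2 * gradE G i j q =
      -∫ q : ℝ × (EuclideanSpace ℝ (Fin 3)), fderiv ℝ (φ q.1) q.2 ((EuclideanSpace.single j (1 : ℝ))) * velC u i q := by
  have h := hG.integral_fderiv_mul_inner_eq φ hφ ((EuclideanSpace.single j (1 : ℝ))) ((EuclideanSpace.single i (1 : ℝ)))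
  simp only [inner_single_right_one] at h
  have hu : LocallyIntegrableOn (uncurry u) ((Ioo t₁ t₂ ×ˢ ball x₀ R)) volume :=
    hG.locallyIntegrableOn
  have IL : Integrable (fun q : ℝ × (EuclideanSpace ℝ (Fin 3)) => fderiv ℝ (φ q.1) q.2 ((EuclideanSpace.single j (1 : ℝ))) * velC u i q)
      (volume : Measure (ℝ × (EuclideanSpace ℝ (Fin 3)))) :=
    integrable_test_mul (locallyIntegrableOn_velC hu i) (isSpaceTimeTestOn_fderiv_apply hφ ((EuclideanSpace.single j (1 : ℝ))))
  have IR : Integrable (fun q : ℝ × (EuclideanSpace ℝ (Fin 3)) => φ q.1 q.2 * gradE G i j q) (volume : Measure (ℝ × (EuclideanSpace ℝ (Fin 3)))) :=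
    integrable_test_mul (locallyIntegrableOn_gradE hG.locallyIntegrableOn_grad i j) hφ
  have e1 : ∫ q : ℝ × (EuclideanSpace ℝ (Fin 3)), fderiv ℝ (φ q.1) q.2 ((EuclideanSpace.single j (1 : ℝ))) * velC u i q =
      ∫ t, ∫ x, fderiv ℝ (φ t) x ((EuclideanSpace.single j (1 : ℝ))) * u t x i := by
    have := IL
    rw [Measure.volume_eq_prod] at this ⊢
    exact integral_prod _ this
  have e2 : ∫ q : ℝ × (EuclideanSpace ℝ (Fin 3)), φ q.1 q.2 * gradE G i j q = ∫ t, ∫ x, φ t x * G t x ((EuclideanSpace.single j (1 : ℝ))) i := by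
    have := IR
    rw [Measure.volume_eq_prod] at this ⊢
    exact integral_prod _ this
  rw [e1, e2, h, neg_neg]

/-- **The weak product rule in coordinates**:
`∫∫ (∂ₐθ) uᵢuₖ = -∫∫ θ (uᵢ G_{ka} + uₖ G_{ia})`. [folklore] -/
theorem integral_fderiv_mul_velC_mul_velC
    (hbd : ∀ᵐ q ∂(volume.restrict ((Ioo t₁ t₂ ×ˢ ball x₀ R))), ‖u q.1 q.2‖ ≤ M)
    (hG : HasWeakSpatialGradientOn ((⟨Ioo t₁ t₂ ×ˢ ball x₀ R, isOpen_Ioo.prod isOpen_ball⟩ : Opens (ℝ × (EuclideanSpace ℝ (Fin 3))))) u G)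
    (hG2 : ∫⁻ q in Ioo t₁ t₂ ×ˢ ball x₀ R, ENNReal.ofReal (frobeniusNormSq (G q.1 q.2)) < ⊤)
    {θ : ℝ → (EuclideanSpace ℝ (Fin 3)) → ℝ} (hθ : IsSpaceTimeTestOn ((⟨Ioo t₁ t₂ ×ˢ ball x₀ R, isOpen_Ioo.prod isOpen_ball⟩ : Opens (ℝ × (EuclideanSpace ℝ (Fin 3))))) θ)
    (a i k : Fin 3) :
    ∫ q : ℝ × (EuclideanSpace ℝ (Fin 3)), fderiv ℝ (θ q.1) q.2 ((EuclideanSpace.single a (1 : ℝ))) * (velC u i q * velC u k q) =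
      -∫ q : ℝ × (EuclideanSpace ℝ (Fin 3)), θ q.1 q.2 * (velC u i q * gradE G k a q + velC u k q * gradE G i a q) := by
  have h := integral_fderiv_mul_inner_mul_inner hbd hG hG2 hθ ((EuclideanSpace.single a (1 : ℝ))) ((EuclideanSpace.single i (1 : ℝ))) ((EuclideanSpace.single k (1 : ℝ)))
  simpa using h

/-- The trace term drops out: `∫∫ θ uᵢ tr G = 0`, since `tr G = 0` a.e. on the cylinder
(`SerrinBoundedHolder.ae_trace_eq_zero`) and `θ` vanishes off it. [folklore] -/
theorem integral_test_mul_velC_mul_trace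
    (hsol : IsDistributionalNSSolutionOn ((⟨Ioo t₁ t₂ ×ˢ ball x₀ R, isOpen_Ioo.prod isOpen_ball⟩ : Opens (ℝ × (EuclideanSpace ℝ (Fin 3))))) 1 0 u p)
    (hG : HasWeakSpatialGradientOn ((⟨Ioo t₁ t₂ ×ˢ ball x₀ R, isOpen_Ioo.prod isOpen_ball⟩ : Opens (ℝ × (EuclideanSpace ℝ (Fin 3))))) u G)
    {θ : ℝ → (EuclideanSpace ℝ (Fin 3)) → ℝ} (hθ : IsSpaceTimeTestOn ((⟨Ioo t₁ t₂ ×ˢ ball x₀ R, isOpen_Ioo.prod isOpen_ball⟩ : Opens (ℝ × (EuclideanSpace ℝ (Fin 3))))) θ) (i : Fin 3) :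
    ∫ q : ℝ × (EuclideanSpace ℝ (Fin 3)), θ q.1 q.2 * (velC u i q * ∑ j, gradE G j j q) = 0 := by
  refine integral_eq_zero_of_ae ?_
  filter_upwards [SerrinBoundedHolder.ae_trace_eq_zero hsol hG] with q hq
  by_cases hmem : q ∈ ((⟨Ioo t₁ t₂ ×ˢ ball x₀ R, isOpen_Ioo.prod isOpen_ball⟩ : Opens (ℝ × (EuclideanSpace ℝ (Fin 3)))) : Set (ℝ × (EuclideanSpace ℝ (Fin 3))))
  · have := hq hmem
    simp only [gradE_apply, Pi.zero_apply]
    rw [this, mul_zero, mul_zero]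
  · have h0 : θ q.1 q.2 = 0 := hθ.apply_eq_zero (by simpa using hmem)
    simp [h0]

/-- **The momentum equation against the divergence-free test field `Ψ = -(∂_cψ) e_b + (∂_bψ) e_c`**
(the curl-type test field `ε`-contracted with `eᵢ`; Robinson–Rodrigo–Sadowski 2016, proof of
Thm. 12.1: "`curl φ` is divergence free and as a consequence can be used as a test function"). With
`∂ₜΨ + ΔΨ = -(∂_c(∂ₜψ + Δψ)) e_b + (∂_b(∂ₜψ + Δψ)) e_c` (Schwarz), `div Ψ = 0` (Schwarz) and
`⟪u, (u·∇)Ψ⟫ = -u_b Σⱼ uⱼ ∂ⱼ∂_cψ + u_c Σⱼ uⱼ ∂ⱼ∂_bψ`, the momentum equation reads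
`-∫∫ ∂_c(∂ₜψ+Δψ) u_b + ∫∫ ∂_b(∂ₜψ+Δψ) u_c - ∫∫ Σⱼ (∂ⱼ∂_cψ) uⱼu_b + ∫∫ Σⱼ (∂ⱼ∂_bψ) uⱼu_c = 0`.
[cite: RobinsonRodrigoSadowskiCUP2016, Thm. 12.1, proof, (12.5)] -/
theorem momentum_pairField
    (hsol : IsDistributionalNSSolutionOn ((⟨Ioo t₁ t₂ ×ˢ ball x₀ R, isOpen_Ioo.prod isOpen_ball⟩ : Opens (ℝ × (EuclideanSpace ℝ (Fin 3))))) 1 0 u p)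
    (hbd : ∀ᵐ q ∂(volume.restrict ((Ioo t₁ t₂ ×ˢ ball x₀ R))), ‖u q.1 q.2‖ ≤ M)
    {ψ : ℝ → (EuclideanSpace ℝ (Fin 3)) → ℝ} (hψ : IsSpaceTimeTestOn ((⟨Ioo t₁ t₂ ×ˢ ball x₀ R, isOpen_Ioo.prod isOpen_ball⟩ : Opens (ℝ × (EuclideanSpace ℝ (Fin 3))))) ψ) (b c : Fin 3) :
    (-∫ q : ℝ × (EuclideanSpace ℝ (Fin 3)), fderiv ℝ (heatTest ψ q.1) q.2 ((EuclideanSpace.single c (1 : ℝ))) * velC u b q)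
      + (∫ q : ℝ × (EuclideanSpace ℝ (Fin 3)), fderiv ℝ (heatTest ψ q.1) q.2 ((EuclideanSpace.single b (1 : ℝ))) * velC u c q)
      - (∫ q : ℝ × (EuclideanSpace ℝ (Fin 3)), ∑ j, fderiv ℝ (fun y => fderiv ℝ (ψ q.1) y ((EuclideanSpace.single c (1 : ℝ)))) q.2 ((EuclideanSpace.single j (1 : ℝ))) *
          (velC u j q * velC u b q))
      + (∫ q : ℝ × (EuclideanSpace ℝ (Fin 3)), ∑ j, fderiv ℝ (fun y => fderiv ℝ (ψ q.1) y ((EuclideanSpace.single b (1 : ℝ)))) q.2 ((EuclideanSpace.single j (1 : ℝ))) *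
          (velC u j q * velC u c q)) = 0 := by
  have hu : LocallyIntegrableOn (uncurry u) ((Ioo t₁ t₂ ×ˢ ball x₀ R)) volume := hsol.1
  have hmom := hsol.2.2.2.2
  set Q : Opens (ℝ × (EuclideanSpace ℝ (Fin 3))) := (⟨Ioo t₁ t₂ ×ˢ ball x₀ R, isOpen_Ioo.prod isOpen_ball⟩ : Opens (ℝ × (EuclideanSpace ℝ (Fin 3)))) with hQ
  -- the test fields
  set θ₁ : ℝ → (EuclideanSpace ℝ (Fin 3)) → ℝ := fun t x => fderiv ℝ (ψ t) x ((EuclideanSpace.single c (1 : ℝ))) with hθ₁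
  set θ₂ : ℝ → (EuclideanSpace ℝ (Fin 3)) → ℝ := fun t x => fderiv ℝ (ψ t) x ((EuclideanSpace.single b (1 : ℝ))) with hθ₂
  have hθ₁t : IsSpaceTimeTestOn Q θ₁ := isSpaceTimeTestOn_fderiv_apply hψ ((EuclideanSpace.single c (1 : ℝ)))
  have hθ₂t : IsSpaceTimeTestOn Q θ₂ := isSpaceTimeTestOn_fderiv_apply hψ ((EuclideanSpace.single b (1 : ℝ)))
  have hχ : IsSpaceTimeTestOn Q (heatTest ψ) := isSpaceTimeTestOn_heatTest hψ
  have hΨ : IsSpaceTimeTestOn Q (pairField θ₁ θ₂ (-((EuclideanSpace.single b (1 : ℝ)))) ((EuclideanSpace.single c (1 : ℝ)))) :=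
    isSpaceTimeTestOn_pairField hθ₁t hθ₂t _ _
  have hψ2 : ∀ t, ContDiff ℝ 2 (ψ t) := fun t => contDiff_infty.1 (hψ.contDiff_slice t) 2
  -- the momentum equation against `Ψ`, pointwise rewritten
  have key := hmom _ hΨ
  have hpt : ∀ q : ℝ × (EuclideanSpace ℝ (Fin 3)),
      ⟪u q.1 q.2, timeDeriv (pairField θ₁ θ₂ (-((EuclideanSpace.single b (1 : ℝ)))) ((EuclideanSpace.single c (1 : ℝ)))) q.1 q.2⟫ +
        ⟪u q.1 q.2, convect (u q.1) (pairField θ₁ θ₂ (-((EuclideanSpace.single b (1 : ℝ)))) ((EuclideanSpace.single c (1 : ℝ))) q.1) q.2⟫ +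
        1 * ⟪u q.1 q.2, Δ (pairField θ₁ θ₂ (-((EuclideanSpace.single b (1 : ℝ)))) ((EuclideanSpace.single c (1 : ℝ))) q.1) q.2⟫ +
        p q.1 q.2 * VectorCalculus.divergence (pairField θ₁ θ₂ (-((EuclideanSpace.single b (1 : ℝ)))) ((EuclideanSpace.single c (1 : ℝ))) q.1) q.2 +
        ⟪(0 : ℝ → (EuclideanSpace ℝ (Fin 3)) → (EuclideanSpace ℝ (Fin 3))) q.1 q.2, pairField θ₁ θ₂ (-((EuclideanSpace.single b (1 : ℝ)))) ((EuclideanSpace.single c (1 : ℝ))) q.1 q.2⟫ =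
      -(fderiv ℝ (heatTest ψ q.1) q.2 ((EuclideanSpace.single c (1 : ℝ))) * velC u b q) +
        fderiv ℝ (heatTest ψ q.1) q.2 ((EuclideanSpace.single b (1 : ℝ))) * velC u c q -
        (∑ j, fderiv ℝ (θ₁ q.1) q.2 ((EuclideanSpace.single j (1 : ℝ))) * (velC u j q * velC u b q)) +
        ∑ j, fderiv ℝ (θ₂ q.1) q.2 ((EuclideanSpace.single j (1 : ℝ))) * (velC u j q * velC u c q) := by
    rintro ⟨t, x⟩
    have e1 := timeDeriv_pairField (v₁ := -((EuclideanSpace.single b (1 : ℝ)))) (v₂ := ((EuclideanSpace.single c (1 : ℝ)))) hθ₁t hθ₂t t x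
    have e2 := convect_pairField (v₁ := -((EuclideanSpace.single b (1 : ℝ)))) (v₂ := ((EuclideanSpace.single c (1 : ℝ)))) hθ₁t hθ₂t (u t) t x
    have e3 := laplacian_pairField (v₁ := -((EuclideanSpace.single b (1 : ℝ)))) (v₂ := ((EuclideanSpace.single c (1 : ℝ)))) hθ₁t hθ₂t t x
    have e4 := divergence_pairField (v₁ := -((EuclideanSpace.single b (1 : ℝ)))) (v₂ := ((EuclideanSpace.single c (1 : ℝ)))) hθ₁t hθ₂t t x
    -- Schwarz: the divergence vanishes
    have hS : fderiv ℝ (θ₁ t) x ((EuclideanSpace.single b (1 : ℝ))) = fderiv ℝ (θ₂ t) x ((EuclideanSpace.single c (1 : ℝ))) :=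
      SerrinBoundedHolder.fderiv_fderiv_apply_comm (hψ2 t) x ((EuclideanSpace.single c (1 : ℝ))) ((EuclideanSpace.single b (1 : ℝ)))
    -- `∂ₜ∂ψ + Δ∂ψ = ∂(∂ₜψ + Δψ)`
    have hT1 : fderiv ℝ (heatTest ψ t) x ((EuclideanSpace.single c (1 : ℝ))) = timeDeriv θ₁ t x + Δ (θ₁ t) x :=
      fderiv_timeDeriv_add_laplacian hψ ((EuclideanSpace.single c (1 : ℝ))) t x
    have hT2 : fderiv ℝ (heatTest ψ t) x ((EuclideanSpace.single b (1 : ℝ))) = timeDeriv θ₂ t x + Δ (θ₂ t) x :=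
      fderiv_timeDeriv_add_laplacian hψ ((EuclideanSpace.single b (1 : ℝ))) t x
    -- the convective terms in coordinates
    have hC1 : fderiv ℝ (θ₁ t) x (u t x) = ∑ j, u t x j * fderiv ℝ (θ₁ t) x ((EuclideanSpace.single j (1 : ℝ))) :=
      clm_apply_eq_sum _ _
    have hC2 : fderiv ℝ (θ₂ t) x (u t x) = ∑ j, u t x j * fderiv ℝ (θ₂ t) x ((EuclideanSpace.single j (1 : ℝ))) :=
      clm_apply_eq_sum _ _
    have hC1' : fderiv ℝ (θ₁ t) x (u t x) * u t x b =
        ∑ j, fderiv ℝ (θ₁ t) x ((EuclideanSpace.single j (1 : ℝ))) * (u t x j * u t x b) := by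
      rw [hC1, Finset.sum_mul]
      exact Finset.sum_congr rfl fun j _ => by ring
    have hC2' : fderiv ℝ (θ₂ t) x (u t x) * u t x c =
        ∑ j, fderiv ℝ (θ₂ t) x ((EuclideanSpace.single j (1 : ℝ))) * (u t x j * u t x c) := by
      rw [hC2, Finset.sum_mul]
      exact Finset.sum_congr rfl fun j _ => by ring
    rw [e1, e2, e3, e4]
    simp only [inner_add_right, inner_smul_right, inner_neg_right, inner_single_right_one, map_neg,
      Pi.zero_apply, inner_zero_left, velC_apply, hS, hT1, hT2]
    linear_combination (-1 : ℝ) * hC1' + hC2'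
  -- the rewritten integrand, as a function on space–time
  set T : ℝ × (EuclideanSpace ℝ (Fin 3)) → ℝ := fun q =>
      -(fderiv ℝ (heatTest ψ q.1) q.2 ((EuclideanSpace.single c (1 : ℝ))) * velC u b q) +
        fderiv ℝ (heatTest ψ q.1) q.2 ((EuclideanSpace.single b (1 : ℝ))) * velC u c q -
        (∑ j, fderiv ℝ (θ₁ q.1) q.2 ((EuclideanSpace.single j (1 : ℝ))) * (velC u j q * velC u b q)) +
        ∑ j, fderiv ℝ (θ₂ q.1) q.2 ((EuclideanSpace.single j (1 : ℝ))) * (velC u j q * velC u c q) with hT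
  have key' : ∫ q in (Q : Set (ℝ × (EuclideanSpace ℝ (Fin 3)))), T q = 0 := by
    rw [← key]
    exact setIntegral_congr_fun Q.isOpen.measurableSet fun q _ => (hpt q).symm
  -- `T` vanishes off `Q`
  have hdχc := isSpaceTimeTestOn_fderiv_apply hχ ((EuclideanSpace.single c (1 : ℝ)))
  have hdχb := isSpaceTimeTestOn_fderiv_apply hχ ((EuclideanSpace.single b (1 : ℝ)))
  have hdθ₁ := fun j : Fin 3 => isSpaceTimeTestOn_fderiv_apply hθ₁t ((EuclideanSpace.single j (1 : ℝ)))
  have hdθ₂ := fun j : Fin 3 => isSpaceTimeTestOn_fderiv_apply hθ₂t ((EuclideanSpace.single j (1 : ℝ)))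
  have hT0 : ∀ q, q ∉ (Q : Set (ℝ × (EuclideanSpace ℝ (Fin 3)))) → T q = 0 := by
    intro q hq
    have hq' : (q.1, q.2) ∉ (Q : Set (ℝ × (EuclideanSpace ℝ (Fin 3)))) := by simpa using hq
    have z1 : fderiv ℝ (heatTest ψ q.1) q.2 ((EuclideanSpace.single c (1 : ℝ))) = 0 := hdχc.apply_eq_zero hq'
    have z2 : fderiv ℝ (heatTest ψ q.1) q.2 ((EuclideanSpace.single b (1 : ℝ))) = 0 := hdχb.apply_eq_zero hq'
    have z3 : ∀ j, fderiv ℝ (θ₁ q.1) q.2 ((EuclideanSpace.single j (1 : ℝ))) = 0 := fun j => (hdθ₁ j).apply_eq_zero hq'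
    have z4 : ∀ j, fderiv ℝ (θ₂ q.1) q.2 ((EuclideanSpace.single j (1 : ℝ))) = 0 := fun j => (hdθ₂ j).apply_eq_zero hq'
    simp [hT, z1, z2, z3, z4]
  have hwhole : ∫ q, T q = 0 := by
    rw [← setIntegral_eq_integral_of_forall_compl_eq_zero hT0]
    exact key'
  -- split the integral
  have I1 : Integrable (fun q : ℝ × (EuclideanSpace ℝ (Fin 3)) => fderiv ℝ (heatTest ψ q.1) q.2 ((EuclideanSpace.single c (1 : ℝ))) * velC u b q)
      (volume : Measure (ℝ × (EuclideanSpace ℝ (Fin 3)))) := integrable_test_mul (locallyIntegrableOn_velC hu b) hdχc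
  have I2 : Integrable (fun q : ℝ × (EuclideanSpace ℝ (Fin 3)) => fderiv ℝ (heatTest ψ q.1) q.2 ((EuclideanSpace.single b (1 : ℝ))) * velC u c q)
      (volume : Measure (ℝ × (EuclideanSpace ℝ (Fin 3)))) := integrable_test_mul (locallyIntegrableOn_velC hu c) hdχb
  have I3 : Integrable (fun q : ℝ × (EuclideanSpace ℝ (Fin 3)) =>
      ∑ j, fderiv ℝ (θ₁ q.1) q.2 ((EuclideanSpace.single j (1 : ℝ))) * (velC u j q * velC u b q)) (volume : Measure (ℝ × (EuclideanSpace ℝ (Fin 3)))) :=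
    integrable_finsetSum _ fun j _ =>
      integrable_test_mul (locallyIntegrableOn_velC_mul_velC hu hbd j b) (hdθ₁ j)
  have I4 : Integrable (fun q : ℝ × (EuclideanSpace ℝ (Fin 3)) =>
      ∑ j, fderiv ℝ (θ₂ q.1) q.2 ((EuclideanSpace.single j (1 : ℝ))) * (velC u j q * velC u c q)) (volume : Measure (ℝ × (EuclideanSpace ℝ (Fin 3)))) :=
    integrable_finsetSum _ fun j _ =>
      integrable_test_mul (locallyIntegrableOn_velC_mul_velC hu hbd j c) (hdθ₂ j)
  have I12 : Integrable (fun q : ℝ × (EuclideanSpace ℝ (Fin 3)) => -(fderiv ℝ (heatTest ψ q.1) q.2 ((EuclideanSpace.single c (1 : ℝ))) * velC u b q) +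
      fderiv ℝ (heatTest ψ q.1) q.2 ((EuclideanSpace.single b (1 : ℝ))) * velC u c q) (volume : Measure (ℝ × (EuclideanSpace ℝ (Fin 3)))) :=
    I1.neg.add I2
  have I123 : Integrable (fun q : ℝ × (EuclideanSpace ℝ (Fin 3)) => -(fderiv ℝ (heatTest ψ q.1) q.2 ((EuclideanSpace.single c (1 : ℝ))) * velC u b q) +
      fderiv ℝ (heatTest ψ q.1) q.2 ((EuclideanSpace.single b (1 : ℝ))) * velC u c q -
      ∑ j, fderiv ℝ (θ₁ q.1) q.2 ((EuclideanSpace.single j (1 : ℝ))) * (velC u j q * velC u b q)) (volume : Measure (ℝ × (EuclideanSpace ℝ (Fin 3)))) :=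
    I12.sub I3
  have I1n : Integrable (fun q : ℝ × (EuclideanSpace ℝ (Fin 3)) => -(fderiv ℝ (heatTest ψ q.1) q.2 ((EuclideanSpace.single c (1 : ℝ))) * velC u b q))
      (volume : Measure (ℝ × (EuclideanSpace ℝ (Fin 3)))) := I1.neg
  have hsplit : ∫ q, T q = (-∫ q : ℝ × (EuclideanSpace ℝ (Fin 3)), fderiv ℝ (heatTest ψ q.1) q.2 ((EuclideanSpace.single c (1 : ℝ))) * velC u b q)
      + (∫ q : ℝ × (EuclideanSpace ℝ (Fin 3)), fderiv ℝ (heatTest ψ q.1) q.2 ((EuclideanSpace.single b (1 : ℝ))) * velC u c q)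
      - (∫ q : ℝ × (EuclideanSpace ℝ (Fin 3)), ∑ j, fderiv ℝ (θ₁ q.1) q.2 ((EuclideanSpace.single j (1 : ℝ))) * (velC u j q * velC u b q))
      + (∫ q : ℝ × (EuclideanSpace ℝ (Fin 3)), ∑ j, fderiv ℝ (θ₂ q.1) q.2 ((EuclideanSpace.single j (1 : ℝ))) * (velC u j q * velC u c q)) := by
    simp only [hT]
    rw [integral_add I123 I4, integral_sub I12 I3, integral_add I1n I2, integral_neg]
  rw [hsplit] at hwhole
  exact hwhole

/-- **The weak vorticity equation in coordinates.** Under the hypotheses of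
`NSSpinHeatEquation` (distributional Navier–Stokes solution on `Q*_R(z)`, `|u| ≤ M`, weak spatial
gradient `G ∈ L²`), for all `b, c` and every `ψ ∈ C_c^∞(Q*_R(z))`,
`∫∫ (G_{bc} - G_{cb})(∂ₜψ + Δψ) = -∫∫ (∂_cψ) Σⱼ uⱼ(G_{bj} - G_{jb}) + ∫∫ (∂_bψ) Σⱼ uⱼ(G_{cj} - G_{jc})`.
Proof (Robinson–Rodrigo–Sadowski 2016, proof of Thm. 12.1, pp. 167–168, antisymmetrised): the
weak-gradient identity against `χ = ∂ₜψ + Δψ` turns the left side into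
`-∫∫ (∂_cχ) u_b + ∫∫ (∂_bχ) u_c`; the momentum equation against `-(∂_cψ) e_b + (∂_bψ) e_c`
(`momentum_pairField`) equates this with `∫∫ Σⱼ (∂ⱼ∂_cψ) uⱼu_b - ∫∫ Σⱼ (∂ⱼ∂_bψ) uⱼu_c`; the weak
product rule (`integral_fderiv_mul_velC_mul_velC`) and `tr G = 0` give
`-∫∫ (∂_cψ) Σⱼ uⱼG_{bj} + ∫∫ (∂_bψ) Σⱼ uⱼG_{cj}`; finally `G_{bj} = A_{bj} + G_{jb}` and
`Σⱼ uⱼG_{jb} = ½∂_b|u|²` weakly, whose contributions cancel by Schwarz (`∂_b∂_cψ = ∂_c∂_bψ`).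
[cite: RobinsonRodrigoSadowskiCUP2016, Thm. 12.1 with (12.4) and its proof] -/
theorem integral_spin_mul_heatTest
    (hsol : IsDistributionalNSSolutionOn ((⟨Ioo t₁ t₂ ×ˢ ball x₀ R, isOpen_Ioo.prod isOpen_ball⟩ : Opens (ℝ × (EuclideanSpace ℝ (Fin 3))))) 1 0 u p)
    (hbd : ∀ᵐ q ∂(volume.restrict ((Ioo t₁ t₂ ×ˢ ball x₀ R))), ‖u q.1 q.2‖ ≤ M)
    (hG : HasWeakSpatialGradientOn ((⟨Ioo t₁ t₂ ×ˢ ball x₀ R, isOpen_Ioo.prod isOpen_ball⟩ : Opens (ℝ × (EuclideanSpace ℝ (Fin 3))))) u G)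
    (hG2 : ∫⁻ q in Ioo t₁ t₂ ×ˢ ball x₀ R, ENNReal.ofReal (frobeniusNormSq (G q.1 q.2)) < ⊤)
    (b c : Fin 3) {ψ : ℝ → (EuclideanSpace ℝ (Fin 3)) → ℝ} (hψ : IsSpaceTimeTestOn ((⟨Ioo t₁ t₂ ×ˢ ball x₀ R, isOpen_Ioo.prod isOpen_ball⟩ : Opens (ℝ × (EuclideanSpace ℝ (Fin 3))))) ψ) :
    ∫ q : ℝ × (EuclideanSpace ℝ (Fin 3)), (gradE G b c q - gradE G c b q) * heatTest ψ q.1 q.2 =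
      -(∫ q : ℝ × (EuclideanSpace ℝ (Fin 3)), fderiv ℝ (ψ q.1) q.2 ((EuclideanSpace.single c (1 : ℝ))) * ∑ j, velC u j q * (gradE G b j q - gradE G j b q))
      + ∫ q : ℝ × (EuclideanSpace ℝ (Fin 3)), fderiv ℝ (ψ q.1) q.2 ((EuclideanSpace.single b (1 : ℝ))) * ∑ j, velC u j q * (gradE G c j q - gradE G j c q) := by
  have hu : LocallyIntegrableOn (uncurry u) ((Ioo t₁ t₂ ×ˢ ball x₀ R)) volume := hsol.1
  have hGl : LocallyIntegrableOn (uncurry G) ((Ioo t₁ t₂ ×ˢ ball x₀ R)) volume :=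
    hG.locallyIntegrableOn_grad
  set Q : Opens (ℝ × (EuclideanSpace ℝ (Fin 3))) := (⟨Ioo t₁ t₂ ×ˢ ball x₀ R, isOpen_Ioo.prod isOpen_ball⟩ : Opens (ℝ × (EuclideanSpace ℝ (Fin 3)))) with hQ
  set θ₁ : ℝ → (EuclideanSpace ℝ (Fin 3)) → ℝ := fun t x => fderiv ℝ (ψ t) x ((EuclideanSpace.single c (1 : ℝ))) with hθ₁
  set θ₂ : ℝ → (EuclideanSpace ℝ (Fin 3)) → ℝ := fun t x => fderiv ℝ (ψ t) x ((EuclideanSpace.single b (1 : ℝ))) with hθ₂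
  have hθ₁t : IsSpaceTimeTestOn Q θ₁ := isSpaceTimeTestOn_fderiv_apply hψ ((EuclideanSpace.single c (1 : ℝ)))
  have hθ₂t : IsSpaceTimeTestOn Q θ₂ := isSpaceTimeTestOn_fderiv_apply hψ ((EuclideanSpace.single b (1 : ℝ)))
  have hχ : IsSpaceTimeTestOn Q (heatTest ψ) := isSpaceTimeTestOn_heatTest hψ
  have hψ2 : ∀ t, ContDiff ℝ 2 (ψ t) := fun t => contDiff_infty.1 (hψ.contDiff_slice t) 2
  -- integrability facts
  have Iχ : ∀ i j, Integrable (fun q : ℝ × (EuclideanSpace ℝ (Fin 3)) => heatTest ψ q.1 q.2 * gradE G i j q)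
      (volume : Measure (ℝ × (EuclideanSpace ℝ (Fin 3)))) := fun i j =>
    integrable_test_mul (locallyIntegrableOn_gradE hGl i j) hχ
  have Iθ : ∀ {θ : ℝ → (EuclideanSpace ℝ (Fin 3)) → ℝ}, IsSpaceTimeTestOn Q θ → ∀ j i k,
      Integrable (fun q : ℝ × (EuclideanSpace ℝ (Fin 3)) => θ q.1 q.2 * (velC u j q * gradE G i k q))
        (volume : Measure (ℝ × (EuclideanSpace ℝ (Fin 3)))) :=
    fun hθ j i k => integrable_test_mul (locallyIntegrableOn_velC_mul_gradE hu hbd hGl j i k) hθ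
  have IA : ∀ {θ : ℝ → (EuclideanSpace ℝ (Fin 3)) → ℝ}, IsSpaceTimeTestOn Q θ → ∀ j i,
      Integrable (fun q : ℝ × (EuclideanSpace ℝ (Fin 3)) => θ q.1 q.2 * (velC u j q * (gradE G i j q - gradE G j i q)))
        (volume : Measure (ℝ × (EuclideanSpace ℝ (Fin 3)))) := by
    intro θ hθ j i
    refine ((Iθ hθ j i j).sub (Iθ hθ j j i)).congr (Eventually.of_forall fun q => ?_)
    simp only [Pi.sub_apply]
    ring
  -- Step 1: the weak-gradient identity against `χ = ∂ₜψ + Δψ`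
  have s1 := integral_test_mul_gradE hG hχ b c
  have s2 := integral_test_mul_gradE hG hχ c b
  have lhs : ∫ q : ℝ × (EuclideanSpace ℝ (Fin 3)), (gradE G b c q - gradE G c b q) * heatTest ψ q.1 q.2 =
      (∫ q : ℝ × (EuclideanSpace ℝ (Fin 3)), heatTest ψ q.1 q.2 * gradE G b c q) -
        ∫ q : ℝ × (EuclideanSpace ℝ (Fin 3)), heatTest ψ q.1 q.2 * gradE G c b q := by
    rw [← integral_sub (Iχ b c) (Iχ c b)]
    refine integral_congr_ae (Eventually.of_forall fun q => ?_)
    simp only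
    ring
  -- Step 2: the momentum equation against `-(∂_cψ) e_b + (∂_bψ) e_c`
  have m : (-∫ q : ℝ × (EuclideanSpace ℝ (Fin 3)), fderiv ℝ (heatTest ψ q.1) q.2 ((EuclideanSpace.single c (1 : ℝ))) * velC u b q)
      + (∫ q : ℝ × (EuclideanSpace ℝ (Fin 3)), fderiv ℝ (heatTest ψ q.1) q.2 ((EuclideanSpace.single b (1 : ℝ))) * velC u c q)
      - (∫ q : ℝ × (EuclideanSpace ℝ (Fin 3)), ∑ j, fderiv ℝ (θ₁ q.1) q.2 ((EuclideanSpace.single j (1 : ℝ))) * (velC u j q * velC u b q))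
      + (∫ q : ℝ × (EuclideanSpace ℝ (Fin 3)), ∑ j, fderiv ℝ (θ₂ q.1) q.2 ((EuclideanSpace.single j (1 : ℝ))) * (velC u j q * velC u c q)) = 0 :=
    momentum_pairField hsol hbd hψ b c
  -- Step 3: the product rule and the trace
  have pr1 : ∀ j, ∫ q : ℝ × (EuclideanSpace ℝ (Fin 3)), fderiv ℝ (θ₁ q.1) q.2 ((EuclideanSpace.single j (1 : ℝ))) * (velC u j q * velC u b q) =
      -∫ q : ℝ × (EuclideanSpace ℝ (Fin 3)), θ₁ q.1 q.2 * (velC u j q * gradE G b j q + velC u b q * gradE G j j q) :=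
    fun j => integral_fderiv_mul_velC_mul_velC hbd hG hG2 hθ₁t j j b
  have pr2 : ∀ j, ∫ q : ℝ × (EuclideanSpace ℝ (Fin 3)), fderiv ℝ (θ₂ q.1) q.2 ((EuclideanSpace.single j (1 : ℝ))) * (velC u j q * velC u c q) =
      -∫ q : ℝ × (EuclideanSpace ℝ (Fin 3)), θ₂ q.1 q.2 * (velC u j q * gradE G c j q + velC u c q * gradE G j j q) :=
    fun j => integral_fderiv_mul_velC_mul_velC hbd hG hG2 hθ₂t j j c
  have tr1 := integral_test_mul_velC_mul_trace hsol hG hθ₁t b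
  have tr2 := integral_test_mul_velC_mul_trace hsol hG hθ₂t c
  have conv : ∀ {θ : ℝ → (EuclideanSpace ℝ (Fin 3)) → ℝ} (hθ : IsSpaceTimeTestOn Q θ) (i : Fin 3),
      (∀ j, ∫ q : ℝ × (EuclideanSpace ℝ (Fin 3)), fderiv ℝ (θ q.1) q.2 ((EuclideanSpace.single j (1 : ℝ))) * (velC u j q * velC u i q) =
        -∫ q : ℝ × (EuclideanSpace ℝ (Fin 3)), θ q.1 q.2 * (velC u j q * gradE G i j q + velC u i q * gradE G j j q)) →
      ∫ q : ℝ × (EuclideanSpace ℝ (Fin 3)), θ q.1 q.2 * (velC u i q * ∑ j, gradE G j j q) = 0 →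
      ∫ q : ℝ × (EuclideanSpace ℝ (Fin 3)), ∑ j, fderiv ℝ (θ q.1) q.2 ((EuclideanSpace.single j (1 : ℝ))) * (velC u j q * velC u i q) =
        -∑ j, ∫ q : ℝ × (EuclideanSpace ℝ (Fin 3)), θ q.1 q.2 * (velC u j q * gradE G i j q) := by
    intro θ hθ i hpr htr
    have hdθ := fun j : Fin 3 => isSpaceTimeTestOn_fderiv_apply hθ ((EuclideanSpace.single j (1 : ℝ)))
    rw [integral_finsetSum _ fun j _ =>
      integrable_test_mul (locallyIntegrableOn_velC_mul_velC hu hbd j i) (hdθ j)]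
    have hY : ∑ j, ∫ q : ℝ × (EuclideanSpace ℝ (Fin 3)), θ q.1 q.2 * (velC u i q * gradE G j j q) = 0 := by
      rw [← integral_finsetSum _ fun j _ => Iθ hθ i j j, ← htr]
      refine integral_congr_ae (Eventually.of_forall fun q => ?_)
      simp only [Finset.mul_sum]
    have each : ∀ j, ∫ q : ℝ × (EuclideanSpace ℝ (Fin 3)), fderiv ℝ (θ q.1) q.2 ((EuclideanSpace.single j (1 : ℝ))) * (velC u j q * velC u i q) =
        -(∫ q : ℝ × (EuclideanSpace ℝ (Fin 3)), θ q.1 q.2 * (velC u j q * gradE G i j q)) -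
          ∫ q : ℝ × (EuclideanSpace ℝ (Fin 3)), θ q.1 q.2 * (velC u i q * gradE G j j q) := by
      intro j
      have hadd : ∫ q : ℝ × (EuclideanSpace ℝ (Fin 3)), θ q.1 q.2 * (velC u j q * gradE G i j q + velC u i q * gradE G j j q) =
          (∫ q : ℝ × (EuclideanSpace ℝ (Fin 3)), θ q.1 q.2 * (velC u j q * gradE G i j q)) +
            ∫ q : ℝ × (EuclideanSpace ℝ (Fin 3)), θ q.1 q.2 * (velC u i q * gradE G j j q) := by
        rw [← integral_add (Iθ hθ j i j) (Iθ hθ i j j)]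
        refine integral_congr_ae (Eventually.of_forall fun q => ?_)
        simp only
        ring
      rw [hpr j, hadd]
      ring
    calc ∑ j, ∫ q : ℝ × (EuclideanSpace ℝ (Fin 3)), fderiv ℝ (θ q.1) q.2 ((EuclideanSpace.single j (1 : ℝ))) * (velC u j q * velC u i q)
        = ∑ j, (-(∫ q : ℝ × (EuclideanSpace ℝ (Fin 3)), θ q.1 q.2 * (velC u j q * gradE G i j q)) -
            ∫ q : ℝ × (EuclideanSpace ℝ (Fin 3)), θ q.1 q.2 * (velC u i q * gradE G j j q)) :=
          Finset.sum_congr rfl fun j _ => each j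
      _ = -∑ j, (∫ q : ℝ × (EuclideanSpace ℝ (Fin 3)), θ q.1 q.2 * (velC u j q * gradE G i j q)) -
            ∑ j, ∫ q : ℝ × (EuclideanSpace ℝ (Fin 3)), θ q.1 q.2 * (velC u i q * gradE G j j q) := by
          rw [Finset.sum_sub_distrib, Finset.sum_neg_distrib]
      _ = -∑ j, ∫ q : ℝ × (EuclideanSpace ℝ (Fin 3)), θ q.1 q.2 * (velC u j q * gradE G i j q) := by rw [hY, sub_zero]
  have P3 := conv hθ₁t b pr1 tr1
  have P4 := conv hθ₂t c pr2 tr2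
  -- Step 4: `G_{ij} = A_{ij} + G_{ji}`; the symmetric part is `½ ∂|u|²` weakly and cancels
  have dsum : ∀ {θ : ℝ → (EuclideanSpace ℝ (Fin 3)) → ℝ} (hθ : IsSpaceTimeTestOn Q θ) (i : Fin 3),
      ∑ j, ∫ q : ℝ × (EuclideanSpace ℝ (Fin 3)), θ q.1 q.2 * (velC u j q * gradE G i j q) =
        (∑ j, ∫ q : ℝ × (EuclideanSpace ℝ (Fin 3)), θ q.1 q.2 * (velC u j q * (gradE G i j q - gradE G j i q))) +
          ∑ j, ∫ q : ℝ × (EuclideanSpace ℝ (Fin 3)), θ q.1 q.2 * (velC u j q * gradE G j i q) := by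
    intro θ hθ i
    rw [← Finset.sum_add_distrib]
    refine Finset.sum_congr rfl fun j _ => ?_
    rw [← integral_add (IA hθ j i) (Iθ hθ j j i)]
    refine integral_congr_ae (Eventually.of_forall fun q => ?_)
    simp only
    ring
  have dsym : ∀ {θ : ℝ → (EuclideanSpace ℝ (Fin 3)) → ℝ} (hθ : IsSpaceTimeTestOn Q θ) (i : Fin 3),
      ∑ j, ∫ q : ℝ × (EuclideanSpace ℝ (Fin 3)), θ q.1 q.2 * (velC u j q * gradE G j i q) =
        -(1 / 2) * ∑ j, ∫ q : ℝ × (EuclideanSpace ℝ (Fin 3)), fderiv ℝ (θ q.1) q.2 ((EuclideanSpace.single i (1 : ℝ))) * (velC u j q * velC u j q) := by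
    intro θ hθ i
    rw [Finset.mul_sum]
    refine Finset.sum_congr rfl fun j _ => ?_
    have h := integral_fderiv_mul_velC_mul_velC hbd hG hG2 hθ i j j
    have h2 : ∫ q : ℝ × (EuclideanSpace ℝ (Fin 3)), θ q.1 q.2 * (velC u j q * gradE G j i q + velC u j q * gradE G j i q) =
        2 * ∫ q : ℝ × (EuclideanSpace ℝ (Fin 3)), θ q.1 q.2 * (velC u j q * gradE G j i q) := by
      rw [← integral_const_mul]
      refine integral_congr_ae (Eventually.of_forall fun q => ?_)
      ring
    rw [h2] at h
    linarith
  have dsch : ∑ j, ∫ q : ℝ × (EuclideanSpace ℝ (Fin 3)), fderiv ℝ (θ₁ q.1) q.2 ((EuclideanSpace.single b (1 : ℝ))) * (velC u j q * velC u j q) =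
      ∑ j, ∫ q : ℝ × (EuclideanSpace ℝ (Fin 3)), fderiv ℝ (θ₂ q.1) q.2 ((EuclideanSpace.single c (1 : ℝ))) * (velC u j q * velC u j q) := by
    refine Finset.sum_congr rfl fun j _ => ?_
    refine integral_congr_ae (Eventually.of_forall fun q => ?_)
    have hS : fderiv ℝ (θ₁ q.1) q.2 ((EuclideanSpace.single b (1 : ℝ))) = fderiv ℝ (θ₂ q.1) q.2 ((EuclideanSpace.single c (1 : ℝ))) :=
      SerrinBoundedHolder.fderiv_fderiv_apply_comm (hψ2 q.1) q.2 ((EuclideanSpace.single c (1 : ℝ))) ((EuclideanSpace.single b (1 : ℝ)))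
    simp only [hS]
  have dsum1 := dsum hθ₁t b
  have dsum2 := dsum hθ₂t c
  have dsym1 := dsym hθ₁t b
  have dsym2 := dsym hθ₂t c
  -- the right-hand side sums
  have rhs1 : ∫ q : ℝ × (EuclideanSpace ℝ (Fin 3)), fderiv ℝ (ψ q.1) q.2 ((EuclideanSpace.single c (1 : ℝ))) *
      ∑ j, velC u j q * (gradE G b j q - gradE G j b q) =
      ∑ j, ∫ q : ℝ × (EuclideanSpace ℝ (Fin 3)), θ₁ q.1 q.2 * (velC u j q * (gradE G b j q - gradE G j b q)) := by
    rw [← integral_finsetSum _ fun j _ => IA hθ₁t j b]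
    refine integral_congr_ae (Eventually.of_forall fun q => ?_)
    simp only [Finset.mul_sum]
    rfl
  have rhs2 : ∫ q : ℝ × (EuclideanSpace ℝ (Fin 3)), fderiv ℝ (ψ q.1) q.2 ((EuclideanSpace.single b (1 : ℝ))) *
      ∑ j, velC u j q * (gradE G c j q - gradE G j c q) =
      ∑ j, ∫ q : ℝ × (EuclideanSpace ℝ (Fin 3)), θ₂ q.1 q.2 * (velC u j q * (gradE G c j q - gradE G j c q)) := by
    rw [← integral_finsetSum _ fun j _ => IA hθ₂t j c]
    refine integral_congr_ae (Eventually.of_forall fun q => ?_)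
    simp only [Finset.mul_sum]
    rfl
  rw [lhs, s1, s2, rhs1, rhs2]
  linarith [m, P3, P4, dsum1, dsum2, dsym1, dsym2, dsch]

/-- Integrability of a test function times the flux sums `Σⱼ uⱼ (G_{ij} - G_{ji})`. [folklore] -/
theorem integrable_test_mul_fluxSum
    (hu : LocallyIntegrableOn (uncurry u) ((Ioo t₁ t₂ ×ˢ ball x₀ R)) volume)
    (hbd : ∀ᵐ q ∂(volume.restrict ((Ioo t₁ t₂ ×ˢ ball x₀ R))), ‖u q.1 q.2‖ ≤ M)
    (hGl : LocallyIntegrableOn (uncurry G) ((Ioo t₁ t₂ ×ˢ ball x₀ R)) volume)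
    {θ : ℝ → (EuclideanSpace ℝ (Fin 3)) → ℝ} (hθ : IsSpaceTimeTestOn ((⟨Ioo t₁ t₂ ×ˢ ball x₀ R, isOpen_Ioo.prod isOpen_ball⟩ : Opens (ℝ × (EuclideanSpace ℝ (Fin 3))))) θ) (i : Fin 3) :
    Integrable (fun q : ℝ × (EuclideanSpace ℝ (Fin 3)) => θ q.1 q.2 * ∑ j, velC u j q * (gradE G i j q - gradE G j i q))
      (volume : Measure (ℝ × (EuclideanSpace ℝ (Fin 3)))) := by
  have Iθ : ∀ j i k, Integrable (fun q : ℝ × (EuclideanSpace ℝ (Fin 3)) => θ q.1 q.2 * (velC u j q * gradE G i k q))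
      (volume : Measure (ℝ × (EuclideanSpace ℝ (Fin 3)))) :=
    fun j i k => integrable_test_mul (locallyIntegrableOn_velC_mul_gradE hu hbd hGl j i k) hθ
  have IA : ∀ j, Integrable (fun q : ℝ × (EuclideanSpace ℝ (Fin 3)) => θ q.1 q.2 * (velC u j q * (gradE G i j q - gradE G j i q)))
      (volume : Measure (ℝ × (EuclideanSpace ℝ (Fin 3)))) := by
    intro j
    refine ((Iθ j i j).sub (Iθ j j i)).congr (Eventually.of_forall fun q => ?_)
    simp only [Pi.sub_apply]
    ring
  refine (integrable_finsetSum Finset.univ fun j _ => IA j).congr (Eventually.of_forall fun q => ?_)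
  simp only [Finset.mul_sum]

/-- **The weak vorticity (spin) equation on a product cylinder** `]t₁, t₂[ × B(x₀, R)`
(Robinson–Rodrigo–Sadowski 2016, Thm. 12.1 with (12.4), local form of §13.3.2 Step 1): for a
bounded distributional Navier–Stokes solution (`ν = 1`, no force) with weak spatial gradient
`G ∈ L²` on the cylinder, every entry `A_{bc} = G_{bc} - G_{cb}` of `∇u - (∇u)ᵀ` satisfies
`∫∫ A_{bc}(∂ₜψ + Δψ) = ∫∫ ⟪spinFlux u G b c, ∇ψ⟫` against all test functions `ψ` on the cylinder
(the tree's `NSSpinHeatEquation_holds` is the case of centred parabolic cylinders; the proof is the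
same, run on product cylinders, so that it applies to backward cylinders `Q_R(z)` as well).
[cite: RobinsonRodrigoSadowskiCUP2016, Thm. 12.1 with (12.4); local form of §13.3.2 Step 1, (13.11)–(13.12)] -/
theorem spinHeat_identity_prod {u : ℝ → (EuclideanSpace ℝ (Fin 3)) → (EuclideanSpace ℝ (Fin 3))}
    {p : ℝ → (EuclideanSpace ℝ (Fin 3)) → ℝ} {t₁ t₂ : ℝ} {x₀ : EuclideanSpace ℝ (Fin 3)} {R M : ℝ}
    {G : ℝ → (EuclideanSpace ℝ (Fin 3)) → (EuclideanSpace ℝ (Fin 3)) →L[ℝ] (EuclideanSpace ℝ (Fin 3))}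
    (hsol : IsDistributionalNSSolutionOn (⟨Ioo t₁ t₂ ×ˢ ball x₀ R, isOpen_Ioo.prod isOpen_ball⟩ : Opens (ℝ × (EuclideanSpace ℝ (Fin 3)))) 1 0 u p)
    (hbd : ∀ᵐ q ∂(volume.restrict (Ioo t₁ t₂ ×ˢ ball x₀ R)), ‖u q.1 q.2‖ ≤ M)
    (hG : HasWeakSpatialGradientOn (⟨Ioo t₁ t₂ ×ˢ ball x₀ R, isOpen_Ioo.prod isOpen_ball⟩ : Opens (ℝ × (EuclideanSpace ℝ (Fin 3)))) u G)
    (hG2 : ∫⁻ q in Ioo t₁ t₂ ×ˢ ball x₀ R, ENNReal.ofReal (frobeniusNormSq (G q.1 q.2)) < ⊤)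
    (b c : Fin 3) {ψ : ℝ → (EuclideanSpace ℝ (Fin 3)) → ℝ}
    (hψ : IsSpaceTimeTestOn (⟨Ioo t₁ t₂ ×ˢ ball x₀ R, isOpen_Ioo.prod isOpen_ball⟩ : Opens (ℝ × (EuclideanSpace ℝ (Fin 3)))) ψ) :
    ∫ q : ℝ × (EuclideanSpace ℝ (Fin 3)), spinEntry G b c q * (timeDeriv ψ q.1 q.2 + (Δ (ψ q.1)) q.2) =
      ∫ q : ℝ × (EuclideanSpace ℝ (Fin 3)), ⟪spinFlux u G b c q, gradient (ψ q.1) q.2⟫ := by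
  have hu : LocallyIntegrableOn (uncurry u) ((Ioo t₁ t₂ ×ˢ ball x₀ R)) volume := hsol.1
  have hGl : LocallyIntegrableOn (uncurry G) ((Ioo t₁ t₂ ×ˢ ball x₀ R)) volume :=
    hG.locallyIntegrableOn_grad
  have h := integral_spin_mul_heatTest hsol hbd hG hG2 b c hψ
  have eL : (fun q : ℝ × (EuclideanSpace ℝ (Fin 3)) => spinEntry G b c q * (timeDeriv ψ q.1 q.2 + Δ (ψ q.1) q.2)) =
      fun q => (gradE G b c q - gradE G c b q) * heatTest ψ q.1 q.2 := rfl
  have eR : ∀ q : ℝ × (EuclideanSpace ℝ (Fin 3)), ⟪spinFlux u G b c q, gradient (ψ q.1) q.2⟫ =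
      -(fderiv ℝ (ψ q.1) q.2 ((EuclideanSpace.single c (1 : ℝ))) * ∑ j, velC u j q * (gradE G b j q - gradE G j b q)) +
        fderiv ℝ (ψ q.1) q.2 ((EuclideanSpace.single b (1 : ℝ))) * ∑ j, velC u j q * (gradE G c j q - gradE G j c q) := by
    intro q
    simp only [spinFlux, spinEntry, inner_add_left, real_inner_smul_left, inner_single_left_one,
      SerrinBoundedHolder.gradient_coord, velC_apply, gradE_apply]
    ring
  have I1 : Integrable (fun q : ℝ × (EuclideanSpace ℝ (Fin 3)) =>
      fderiv ℝ (ψ q.1) q.2 ((EuclideanSpace.single c (1 : ℝ))) * ∑ j, velC u j q * (gradE G b j q - gradE G j b q))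
      (volume : Measure (ℝ × (EuclideanSpace ℝ (Fin 3)))) :=
    integrable_test_mul_fluxSum hu hbd hGl (isSpaceTimeTestOn_fderiv_apply hψ ((EuclideanSpace.single c (1 : ℝ)))) b
  have I2 : Integrable (fun q : ℝ × (EuclideanSpace ℝ (Fin 3)) =>
      fderiv ℝ (ψ q.1) q.2 ((EuclideanSpace.single b (1 : ℝ))) * ∑ j, velC u j q * (gradE G c j q - gradE G j c q))
      (volume : Measure (ℝ × (EuclideanSpace ℝ (Fin 3)))) :=
    integrable_test_mul_fluxSum hu hbd hGl (isSpaceTimeTestOn_fderiv_apply hψ ((EuclideanSpace.single b (1 : ℝ)))) c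
  have I1n : Integrable (fun q : ℝ × (EuclideanSpace ℝ (Fin 3)) =>
      -(fderiv ℝ (ψ q.1) q.2 ((EuclideanSpace.single c (1 : ℝ))) * ∑ j, velC u j q * (gradE G b j q - gradE G j b q)))
      (volume : Measure (ℝ × (EuclideanSpace ℝ (Fin 3)))) := I1.neg
  rw [eL, h, integral_congr_ae (Eventually.of_forall eR), integral_add I1n I2, integral_neg]

end NSSpinHeatProd

end Literature.Analysis.FluidPDE

end
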